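import Literature.Geometry.Riemannian.ThreePieceGluedMetric
import Literature.Geometry.Riemannian.CollarGluingPieces
import Literature.Geometry.Riemannian.WarpedSeamMetric
import Literature.Topology.FourManifolds.CollarReparamInPt
import Literature.Topology.FourManifolds.BoundaryGlueDataSeam
import Literature.Geometry.Lorentzian.CurvatureRegularity
import HarnessLib

/-!
# Stub `stub_swapSum` of line `swap-sum` (crux `CorkRegluablePsc`, stmt-SmoothPoincare4-3206) —
# step (3a): the glued PSC metric of two umbilic collared metrics, with its tube formula
# (`--supports` helper)

Support for step (3) of the metrised boundary-sum swap (see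
`WeylBudgetCorkRegluablePscSwapSumBHData.lean` for the plan).  On the three-piece gluing
`P = X ∪_φ Y = (X - ∂X) ∪ (∂X × ℝ) ∪ (Y - ∂Y)` of the tree (`BoundaryGlueData`, Milnor 1965,
Thm. 1.4) along `tanh`-reparametrised collars, two Riemannian PSC metrics which on the collars are
the umbilic `C₀`-normal warped products `ε² ds² + (1 - 2μ ε s - C₀ ε² s²) h` (`μ_Y ∘ φ = -μ_X`,
`h_X = φ^* h_Y`) descend to a Riemannian PSC metric whose pullback to the seam tube is the warped
seam metric `ε²(1 - tanh² t)² dt² + (1 - 2μ_X(z) ε tanh t - C₀ ε² tanh² t) h_X(z)` — this is the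
construction of the landed `stub_collarGluing` (`WeylBudgetCorkRegluablePscStubCollarGluing.lean`)
with the tube formula EXPOSED, so that two such gluings can be compared along their tubes:

* `swapSum_inl_inl_mem_range_jN_iff` — the tube points of the second piece are those with `t ≤ 0`
  (companion of `BoundaryGlueData.inl_inl_mem_range_jM_iff`);
* `swapSum_gluedMetric_of_normalForms` — the glued PSC metric and its tube formula.

No `sorry`; axioms standard; no definitions, no named facts.

References: [ONeill1983] Ch. 3, pp. 90–91, Prop. 3.59; Ch. 7, Def. 7.33; [BarHanke2023] §3,
Def. 21, Cor. 34; [MilnorHCobordism1965] §1, Thm. 1.4; [HirschDT1976] Ch. 8 §2.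
-/

noncomputable section

-- `Summit.<Summit>.<Problem>`: for the single-conjunct summit the duplicate component is mandated.
set_option linter.dupNamespace false

open scoped Manifold ContDiff Topology
open Set Function Filter

namespace Summit.SmoothPoincare4.SmoothPoincare4.Theorems

open Literature.Topology.FourManifolds Literature.Geometry.Lorentzian
  Literature.Geometry.Lorentzian.PseudoRiemannianMetric Literature.Geometry.Riemannian

/-! ### Step (3): the twin collar gluings with isometric seam tubes -/

/-- **The tube points of the piece `jN(N)` are exactly those with `t ≤ 0`** (companion of
`BoundaryGlueData.inl_inl_mem_range_jM_iff`). [folklore] -/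
theorem swapSum_inl_inl_mem_range_jN_iff
    {X : Type} [TopologicalSpace X] [ChartedSpace (EuclideanHalfSpace 4) X] [IsManifold (𝓡∂ 4) ∞ X]
    {bX : BoundaryData (𝓡∂ 4) X (𝓡 3)} [Nonempty bX.carrier]
    {Y : Type} [TopologicalSpace Y] [ChartedSpace (EuclideanHalfSpace 4) Y] [IsManifold (𝓡∂ 4) ∞ Y]
    {bY : BoundaryData (𝓡∂ 4) Y (𝓡 3)} (G : BoundaryGlueData bX bY) (p : bX.carrier × ℝ) :
    G.d₂.inl (G.d₁.inl p) ∈ range G.jN ↔ p.2 ≤ 0 := by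
  constructor
  · rintro ⟨c, hc⟩
    by_contra h
    have h : 0 < p.2 := lt_of_not_ge h
    have h1 : G.jM (G.CM.toFun p.1 p.2) = G.d₂.inl (G.d₁.inl p) := G.jM_toFun p.1 h.le
    obtain ⟨z, hz, -⟩ := G.jM_eq_jN_iff.1 (h1.trans hc.symm)
    have hint : (𝓡∂ 4).IsInteriorPoint (G.CM.toFun p.1 p.2) := G.CM.isInteriorPoint_apply _ h
    rw [hz] at hint
    exact ((𝓡∂ 4).isInteriorPoint_iff_not_isBoundaryPoint _).1 hint (bX.incl_mem_boundary z)
  · intro hp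
    refine ⟨G.CN.toFun (G.φ p.1) (-p.2), ?_⟩
    rw [G.jN_toFun p.1 (by linarith : (0 : ℝ) ≤ -p.2), neg_neg]

set_option maxHeartbeats 1600000 in
/-- **The glued PSC metric of two umbilic collared metrics** (the construction of the landed
`stub_collarGluing`, with the tube formula exposed): on the three-piece gluing `P = X ∪_φ Y`
along the `tanh`-reparametrised collars, Riemannian PSC metrics `g_X`, `g_Y` which on the collars
are `ε² ds² + (1 - 2 μ ε s - C₀ ε² s²) h` (`μ_Y ∘ φ = -μ_X`, `h_X = φ^* h_Y`) descend to a
Riemannian PSC metric `g` whose pullback to the seam tube `∂X × ℝ` is the warped seam metric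
`ε² (1 - tanh² t)² dt² + (1 - 2 μ_X(z) ε tanh t - C₀ ε² tanh² t) h_X(z)`.
[cite: ONeill1983, Ch. 3, pp. 90–91; BarHanke2023, §3 Cor. 34] -/
theorem swapSum_gluedMetric_of_normalForms
    {X : Type} [TopologicalSpace X] [T2Space X] [SecondCountableTopology X] [CompactSpace X]
    [ChartedSpace (EuclideanHalfSpace 4) X] [IsManifold (𝓡∂ 4) ∞ X]
    {bX : BoundaryData (𝓡∂ 4) X (𝓡 3)} [Nonempty bX.carrier]
    {Y : Type} [TopologicalSpace Y] [T2Space Y] [SecondCountableTopology Y] [CompactSpace Y]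
    [ChartedSpace (EuclideanHalfSpace 4) Y] [IsManifold (𝓡∂ 4) ∞ Y]
    {bY : BoundaryData (𝓡∂ 4) Y (𝓡 3)}
    (G : BoundaryGlueData bX bY) (cX : bX.Collar) (cY : bY.Collar)
    (hCM : ∀ x t, G.CM.toFun x t = cX (x, Set.projIcc (0 : ℝ) 1 zero_le_one (Real.tanh t)))
    (hCN : ∀ y t, G.CN.toFun y t = cY (y, Set.projIcc (0 : ℝ) 1 zero_le_one (Real.tanh t)))
    (gX : PseudoRiemannianMetric (𝓡∂ 4) ∞ (EuclideanSpace ℝ (Fin 4)) (TangentSpace (𝓡∂ 4) : X → Type _))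
    [gX.HasLeviCivita]
    (gY : PseudoRiemannianMetric (𝓡∂ 4) ∞ (EuclideanSpace ℝ (Fin 4)) (TangentSpace (𝓡∂ 4) : Y → Type _))
    [gY.HasLeviCivita]
    (μX : bX.carrier → ℝ) (μY : bY.carrier → ℝ) (C₀ ε : ℝ)
    (hRX : gX.IsRiemannian) (hSX : ∀ x, 0 < gX.scalarCurvature x)
    (hRY : gY.IsRiemannian) (hSY : ∀ x, 0 < gY.scalarCurvature x)
    (hε : 0 < ε) (hμ : ContMDiff (𝓡 3) 𝓘(ℝ, ℝ) ∞ μX) (hμY : ∀ z, μY (G.φ z) = -μX z)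
    (hXY : ∀ z, pullbackBilin (I := 𝓡∂ 4) (I' := 𝓡 3) bX.incl gX.val z =
      pullbackBilin (I := 𝓡∂ 4) (I' := 𝓡 3) (bY.incl ∘ G.φ) gY.val z)
    (hcX : ∀ (p : bX.carrier × Set.Icc (0 : ℝ) 1) (V V' : TangentSpace ((𝓡 3).prod (𝓡∂ 1)) p),
      pullbackBilin (I := 𝓡∂ 4) (I' := (𝓡 3).prod (𝓡∂ 1)) cX gX.val p V V' =
        ε ^ 2 * ((show EuclideanSpace ℝ (Fin 1) from V.2) 0 *
          (show EuclideanSpace ℝ (Fin 1) from V'.2) 0) +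
        (1 - 2 * μX p.1 * (ε * (p.2 : ℝ)) - C₀ * (ε * (p.2 : ℝ)) ^ 2) *
          pullbackBilin (I := 𝓡∂ 4) (I' := 𝓡 3) bX.incl gX.val p.1 V.1 V'.1)
    (hcY : ∀ (q : bY.carrier × Set.Icc (0 : ℝ) 1) (V V' : TangentSpace ((𝓡 3).prod (𝓡∂ 1)) q),
      pullbackBilin (I := 𝓡∂ 4) (I' := (𝓡 3).prod (𝓡∂ 1)) cY gY.val q V V' =
        ε ^ 2 * ((show EuclideanSpace ℝ (Fin 1) from V.2) 0 *
          (show EuclideanSpace ℝ (Fin 1) from V'.2) 0) +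
        (1 - 2 * μY q.1 * (ε * (q.2 : ℝ)) - C₀ * (ε * (q.2 : ℝ)) ^ 2) *
          pullbackBilin (I := 𝓡∂ 4) (I' := 𝓡 3) bY.incl gY.val q.1 V.1 V'.1) :
    ∃ (g : PseudoRiemannianMetric (𝓡 4) ∞ (EuclideanSpace ℝ (Fin 4))
        (TangentSpace (𝓡 4) : G.d₂.Glued → Type _)) (_ : g.HasLeviCivita),
      g.IsRiemannian ∧ (∀ x, 0 < g.scalarCurvature x) ∧
      ∀ (p : bX.carrier × ℝ) (v w : TangentSpace ((𝓡 3).prod 𝓘(ℝ, ℝ)) p),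
        g.val (G.d₂.inl (G.d₁.inl p))
          (mfderiv ((𝓡 3).prod 𝓘(ℝ, ℝ)) (𝓡 4) (G.d₂.inl ∘ G.d₁.inl) p v)
          (mfderiv ((𝓡 3).prod 𝓘(ℝ, ℝ)) (𝓡 4) (G.d₂.inl ∘ G.d₁.inl) p w) =
        ε ^ 2 * (1 - Real.tanh p.2 ^ 2) ^ 2 * (v.2 * w.2) +
          (1 - 2 * μX p.1 * (ε * Real.tanh p.2) - C₀ * (ε * Real.tanh p.2) ^ 2) *
            pullbackBilin (I := 𝓡∂ 4) (I' := 𝓡 3) bX.incl gX.val p.1 v.1 w.1 := by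
  haveI : Nonempty X := ⟨bX.incl (Classical.arbitrary _)⟩
  haveI : Nonempty bY.carrier := ⟨G.φ (Classical.arbitrary _)⟩
  haveI : Nonempty Y := ⟨bY.incl (Classical.arbitrary _)⟩
  -- the boundary metric `h = incl^* gX`
  have hsp : gX.IsSpacelikeImmersion (𝓡 3) bX.incl :=
    isSpacelikeImmersion_of_isRiemannian hRX bX.isSmoothEmbedding
  set hB := gX.inducedMetric bX.incl contMDiff_pullbackBilin_holds hsp with hhB
  have hBval : hB.val = pullbackBilin (I := 𝓡∂ 4) (I' := 𝓡 3) bX.incl gX.val := rfl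
  have hBpos : hB.IsRiemannian := isRiemannian_ofRiemannian _
  -- differentiability bookkeeping
  have hinclY : ∀ w, MDifferentiableAt (𝓡 3) (𝓡∂ 4) bY.incl w := fun w ↦
    (bY.isSmoothEmbedding.contMDiff w).mdifferentiableAt (by simp)
  have hφmd : ∀ z, MDifferentiableAt (𝓡 3) (𝓡 3) G.φ z := fun z ↦
    (G.φ.contMDiff z).mdifferentiableAt (by simp)
  -- the warping functions `a = ε² (1 - tanh²)²`, `F = 1 - 2 μ ε tanh - C₀ ε² tanh²`
  set a : bX.carrier × ℝ → ℝ := fun p ↦ ε ^ 2 * (1 - Real.tanh p.2 ^ 2) ^ 2 with ha_def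
  set F : bX.carrier × ℝ → ℝ :=
    fun p ↦ 1 - 2 * μX p.1 * (ε * Real.tanh p.2) - C₀ * (ε * Real.tanh p.2) ^ 2 with hF_def
  have htanh : ContMDiff ((𝓡 3).prod 𝓘(ℝ, ℝ)) 𝓘(ℝ, ℝ) ∞ fun p : bX.carrier × ℝ ↦ Real.tanh p.2 :=
    contDiff_real_tanh.contMDiff.comp contMDiff_snd
  have hμ' : ContMDiff ((𝓡 3).prod 𝓘(ℝ, ℝ)) 𝓘(ℝ, ℝ) ∞ fun p : bX.carrier × ℝ ↦ μX p.1 :=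
    hμ.comp contMDiff_fst
  have ha : ContMDiff ((𝓡 3).prod 𝓘(ℝ, ℝ)) 𝓘(ℝ, ℝ) ∞ a := by
    have h1 : ContDiff ℝ ∞ fun s : ℝ ↦ ε ^ 2 * (1 - s ^ 2) ^ 2 :=
      contDiff_const.mul ((contDiff_const.sub (contDiff_id.pow 2)).pow 2)
    exact h1.contMDiff.comp htanh
  have hF : ContMDiff ((𝓡 3).prod 𝓘(ℝ, ℝ)) 𝓘(ℝ, ℝ) ∞ F := by
    have h1 : ContDiff ℝ ∞ fun ms : ℝ × ℝ ↦
        1 - 2 * ms.1 * (ε * ms.2) - C₀ * (ε * ms.2) ^ 2 :=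
      (contDiff_const.sub ((contDiff_const.mul contDiff_fst).mul
        (contDiff_const.mul contDiff_snd))).sub (contDiff_const.mul
        ((contDiff_const.mul contDiff_snd).pow 2))
    exact h1.contMDiff.comp (hμ'.prodMk_space htanh)
  have ha0 : ∀ p, 0 < a p := fun p ↦ mul_pos (pow_pos hε 2) (pow_pos (one_sub_tanh_sq_pos _) 2)
  have hFXpos := warpingFactor_pos cX gX hRX
    (fun p ↦ 1 - 2 * μX p.1 * (ε * (p.2 : ℝ)) - C₀ * (ε * (p.2 : ℝ)) ^ 2) ε hcX
  have hFYpos := warpingFactor_pos cY gY hRY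
    (fun q ↦ 1 - 2 * μY q.1 * (ε * (q.2 : ℝ)) - C₀ * (ε * (q.2 : ℝ)) ^ 2) ε hcY
  have hF0 : ∀ p, 0 < F p := by
    intro p
    rcases le_or_gt 0 (Real.tanh p.2) with h0 | h0
    · exact hFXpos (p.1, ⟨Real.tanh p.2, h0, (Real.tanh_lt_one _).le⟩)
    · have h := hFYpos (G.φ p.1, ⟨-Real.tanh p.2, by linarith,
        by linarith [Real.neg_one_lt_tanh p.2]⟩)
      have h' : 0 < 1 - 2 * μY (G.φ p.1) * (ε * -Real.tanh p.2) - C₀ * (ε * -Real.tanh p.2) ^ 2 := h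
      rw [hμY] at h'
      show 0 < 1 - 2 * μX p.1 * (ε * Real.tanh p.2) - C₀ * (ε * Real.tanh p.2) ^ 2
      nlinarith [h']
  obtain ⟨gS, hgSr, hgSval⟩ := exists_warpedSeamMetric hB hBpos ha hF ha0 hF0
  haveI hgSlc : gS.HasLeviCivita := gS.hasLeviCivita
  -- the collar of `X` is an isometry on `t > 0`
  have hMiso : ∀ p : bX.carrier × ℝ, 0 < p.2 → ∀ v w : TangentSpace ((𝓡 3).prod 𝓘(ℝ, ℝ)) p,
      gX.val (G.CM.inPt p).val
        (mfderiv ((𝓡 3).prod 𝓘(ℝ, ℝ)) (𝓡∂ 4) (InteriorManifold.val ∘ G.CM.inPt) p v)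
        (mfderiv ((𝓡 3).prod 𝓘(ℝ, ℝ)) (𝓡∂ 4) (InteriorManifold.val ∘ G.CM.inPt) p w) =
      gS.val p v w := by
    intro p hp v w
    have key := val_mfderiv_inPt_eq cX G.CM hCM gX.val
      (fun z ↦ pullbackBilin (I := 𝓡∂ 4) (I' := 𝓡 3) bX.incl gX.val z)
      (fun p ↦ 1 - 2 * μX p.1 * (ε * (p.2 : ℝ)) - C₀ * (ε * (p.2 : ℝ)) ^ 2) ε hcX hp v w
    rw [key, hgSval, Set.projIcc_of_mem zero_le_one (tanh_mem_Icc hp.le)]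
    rw [hBval]
  -- the re-indexed collar of `Y` is an isometry on `t < 0`
  have hNiso : ∀ p : bX.carrier × ℝ, p.2 < 0 → ∀ v w : TangentSpace ((𝓡 3).prod 𝓘(ℝ, ℝ)) p,
      gY.val (G.CN.inPt (G.φ p.1, -p.2)).val
        (mfderiv ((𝓡 3).prod 𝓘(ℝ, ℝ)) (𝓡∂ 4)
          (fun q : bX.carrier × ℝ ↦ (G.CN.inPt (G.φ q.1, -q.2)).val) p v)
        (mfderiv ((𝓡 3).prod 𝓘(ℝ, ℝ)) (𝓡∂ 4)
          (fun q : bX.carrier × ℝ ↦ (G.CN.inPt (G.φ q.1, -q.2)).val) p w) =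
      gS.val p v w := by
    intro p hp v w
    have key := val_mfderiv_inPt_neg_eq cY G.CN hCN gY.val
      (fun w ↦ pullbackBilin (I := 𝓡∂ 4) (I' := 𝓡 3) bY.incl gY.val w)
      (fun q ↦ 1 - 2 * μY q.1 * (ε * (q.2 : ℝ)) - C₀ * (ε * (q.2 : ℝ)) ^ 2) ε hcY (hφmd p.1) hp v w
    have hpr : (Set.projIcc (0 : ℝ) 1 zero_le_one (Real.tanh (-p.2)) : ℝ) = -Real.tanh p.2 := by
      rw [Set.projIcc_of_mem zero_le_one (tanh_mem_Icc (by linarith : (0 : ℝ) ≤ -p.2))]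
      exact Real.tanh_neg p.2
    -- `h_Y(φ z)(dφ v₁, dφ w₁) = (φ^* h_Y)_z(v₁, w₁) = h_X(z)(v₁, w₁)`
    have hh : pullbackBilin (I := 𝓡∂ 4) (I' := 𝓡 3) bY.incl gY.val (G.φ p.1)
        (mfderiv (𝓡 3) (𝓡 3) G.φ p.1 v.1) (mfderiv (𝓡 3) (𝓡 3) G.φ p.1 w.1) =
        hB.val p.1 v.1 w.1 := by
      have h2 : pullbackBilin (I := 𝓡∂ 4) (I' := 𝓡 3) (bY.incl ∘ G.φ) gY.val p.1 v.1 w.1 =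
          pullbackBilin (I := 𝓡∂ 4) (I' := 𝓡 3) bY.incl gY.val (G.φ p.1)
            (mfderiv (𝓡 3) (𝓡 3) G.φ p.1 v.1) (mfderiv (𝓡 3) (𝓡 3) G.φ p.1 w.1) := by
        rw [pullbackBilin_apply, pullbackBilin_apply, mfderiv_comp p.1 (hinclY _) (hφmd p.1)]
        rfl
      rw [← h2, ← hXY p.1, hBval]
    rw [key, hgSval, hpr, hh, hμY]
    simp only [ha_def, hF_def]
    ring
  -- glue the three metrics
  obtain ⟨g, hglc, hgtube, hgR, hgsM, hgsN, hgsS⟩ :=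
    exists_threePieceGluedMetric G gX gY gS hMiso hNiso
  have hgRiem : g.IsRiemannian := hgR hRX hRY hgSr
  -- scalar curvature of the seam metric off `t = 0`
  have hSpos_t : ∀ p : bX.carrier × ℝ, 0 < p.2 →
      gS.scalarCurvature p = gX.scalarCurvature (G.CM.inPt p).val := fun p hp ↦ by
    rw [← hgsS p, G.inl_inl_eq_inl_inr hp, hgsM]
  have hSneg_t : ∀ p : bX.carrier × ℝ, p.2 < 0 →
      gS.scalarCurvature p = gY.scalarCurvature (G.CN.inPt (G.φ p.1, -p.2)).val := fun p hp ↦ by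
    rw [← hgsS p, G.inl_inl_eq_inr_inPt hp, hgsN]
  -- a positive lower bound for `scal gX` on the compact `X`, and `t = 0` by continuity
  obtain ⟨x₀, -, hx₀⟩ := isCompact_univ.exists_isMinOn univ_nonempty
    (gX.contMDiff_scalarCurvature.continuous.continuousOn)
  have hδ : 0 < gX.scalarCurvature x₀ := hSX x₀
  have hδle : ∀ x, gX.scalarCurvature x₀ ≤ gX.scalarCurvature x := fun x ↦
    (isMinOn_iff.1 hx₀) x (mem_univ x)
  have hS0 : ∀ z : bX.carrier, 0 < gS.scalarCurvature (z, 0) := by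
    intro z
    have hcont : Continuous fun t : ℝ ↦ gS.scalarCurvature (z, t) :=
      gS.contMDiff_scalarCurvature.continuous.comp (continuous_const.prodMk continuous_id)
    have htend : Tendsto (fun t : ℝ ↦ gS.scalarCurvature (z, t)) (𝓝[>] 0)
        (𝓝 (gS.scalarCurvature (z, 0))) :=
      (hcont.tendsto 0).mono_left nhdsWithin_le_nhds
    have hev : ∀ᶠ t in 𝓝[>] (0 : ℝ), gX.scalarCurvature x₀ ≤ gS.scalarCurvature (z, t) := by
      filter_upwards [self_mem_nhdsWithin] with t ht
      rw [hSpos_t (z, t) ht]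
      exact hδle _
    exact lt_of_lt_of_le hδ (ge_of_tendsto htend hev)
  have hSall : ∀ p, 0 < gS.scalarCurvature p := by
    rintro ⟨z, t⟩
    rcases lt_trichotomy t 0 with ht | rfl | ht
    · rw [hSneg_t (z, t) ht]
      exact hSY _
    · exact hS0 z
    · rw [hSpos_t (z, t) ht]
      exact hSX _
  have hscal : ∀ x, 0 < g.scalarCurvature x := by
    intro x
    rcases G.exists_tube_or_interior x with ⟨p, rfl⟩ | ⟨a', rfl⟩ | ⟨b', rfl⟩
    · rw [hgsS]
      exact hSall p
    · rw [hgsM]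
      exact hSX _
    · rw [hgsN]
      exact hSY _
  refine ⟨g, hglc, hgRiem, hscal, fun p v w ↦ ?_⟩
  rw [hgtube p v w, hgSval, hBval]

end Summit.SmoothPoincare4.SmoothPoincare4.Theorems

end
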